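import Summits.NavierStokesRegularity.NavierStokesRegularity.Theses.QuantisedSymmetry
import Summits.NavierStokesRegularity.NavierStokesRegularity.Theses.Blowup
import Summits.NavierStokesRegularity.NavierStokesRegularity.Theorems.QuantisedSymmetryPolyhedralDssProfileExistsDominatesBlowupProfile
import Summits.NavierStokesRegularity.NavierStokesRegularity.Theorems.QuantisedSymmetryLiouvilleKillsProfile
import Literature.Dynamics.Hyperbolic.HyperbolicSemiflowModel
import HarnessLib

/-!
# Strategist census r1 — typed companion (crux `PolyhedralDssProfileExists`, stmt-NavierStokesRegularity-1404)

Redirect strategist, family `r`, seat `cstrat-stmt-NavierStokesRegularity-1404-r1`.  NO new route mathematics, NO sorries.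
Companion of `STRATEGY-CENSUS-r1.md`.  PUBLICATION NOTE: at publication time the Lean farm could not serve modules downstream of
`Theses.FilamentSkeletonRss` (`remote:incoherent … FilamentSkeletonRss:mismatch`, the same condition s5 met), so in THIS copy the
landed bridge proof `Theorems.quantisedSymmetry_polyhedralTruncationBridge_proof` (stmt-11331) enters `crux_decides_negatively` as the
hypothesis `hB`; the evidence copy attached to stmt-NavierStokesRegularity-1404 (`StrategistSketchR1Full.lean`, `lean check` rc 0,
0 sorries, 0 warnings, 2026-08-17) imports it and has the hypothesis-free form.  It records, kernel-checked:

* §1 — the theorem that makes the crux summit-strength in the direction the route uses it: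
  `crux_decides_negatively : X⁻ → ¬ NavierStokesRegularity`, i.e. the route glue `QuantisedSymmetry.closes` with its two
  non-`X⁻` binders discharged by LANDED proofs (`Theorems.quantisedSymmetry_polyhedralTruncationBridge_proof`, stmt-11331;
  `ClayUniqueness_holds`, stmt-0153), and `crux_gives_hub : X⁻ → Blowup.BlowupTypeIDssProfile` (stmt-0155, the symmetry-free hub
  crux; tree `stub_dominatesBlowupProfile`, p156644);
* §2 — the pieces of the census's best new split, the CLOSING SPLIT `X⁻ ⇐ P1 ∧ P2 ∧ P3′`: `P1 = AncientPiece := ¬ PolyhedralTypeILiouville`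
  (typed; `ancientPiece_of_crux`), and the tree HOST of the theorem-shaped piece P3′ — `CompactClosingLemma E`, the closing lemma
  over the Literature interface `IsHyperbolicSemiflowModel` / `HasAmbientClosing` (Lian–Young 2012 shape; it is the registered open
  stub `stub_ambientClosing` of the AnomalousDissipation line `ergodic_budget_selection_closing`).  The census explains why the
  backward-similarity Navier–Stokes semiflow does NOT satisfy the field `isCompactOperator_fderiv` (its one-period linearisation is only
  quasi-compact, `S + K` with `‖Sⁿ‖ ≤ c⁻ⁿ`, tree `stub_rdssPeriodPackage`), so P3′ is the `κ < 0` generalisation, and why P2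
  (transversal hyperbolicity of blow-down measures) has no handle;
* §3 — the infinite-dimensional failure of the EVEN-MAP LEMMA behind the lead's EVENMAP protocol: an even, `2`-homogeneous map
  `Q` on sequences, `Q v = 0 ↔ v = 0`, with NO eigen-ray at all (`no_eigenray`).  On `ℓ²` this `Q` is continuous and COMPACT
  (`|Q(v)ᵢ₊₁| ≤ 2⁻ⁱ‖v‖²`, image of a ball inside a Hilbert cube), so neither compactness nor evenness nor non-degeneracy rescues the
  finite-dimensional degree-mod-2 lemma in infinite dimension: "existence at finite N carries no information" is sharp, and the two
  infinite-dimensional eigen-ray theorems in print need exactly the structures Navier–Stokes lacks (gradient structure: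
  Ljusternik–Schnirelmann / Krasnosel'skii, GMNA Thm 57.1–57.2; an invariant cone: nonlinear Krein–Rutman).
-/

noncomputable section

-- the summit namespace `…NavierStokesRegularity.NavierStokesRegularity…` is the tree convention (D-0017)
set_option linter.dupNamespace false

namespace Summit.NavierStokesRegularity.NavierStokesRegularity.Cruxes.PolyhedralDssProfileExists.R1

open MeasureTheory
open _root_.Literature.Analysis.FluidPDE
open _root_.Literature.Dynamics.Hyperbolic

/-- The crux, by name. -/
abbrev Crux : Prop :=
  _root_.Summit.NavierStokesRegularity.NavierStokesRegularity.Theses.QuantisedSymmetry.PolyhedralDssProfileExists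

/-! ## §1 Summit strength (tree theorems only, no hypotheses) -/

/-- **`X⁻ ⇒ ¬NSR`**: `closes` fed with the bridge (stmt-11331 — here the hypothesis `hB`, discharged in the tree by the LANDED
`Theorems.quantisedSymmetry_polyhedralTruncationBridge_proof`, see the publication note) and Clay uniqueness (stmt-0153, landed,
`ClayUniqueness_holds`).  This is the theorem that makes every "weaker intermediate" between the crux and the summit summit-deciding.
[folklore] -/
theorem crux_decides_negatively
    (hB : _root_.Summit.NavierStokesRegularity.NavierStokesRegularity.Theses.QuantisedSymmetry.PolyhedralTruncationBridge)
    (hX : Crux) : ¬ _root_.NavierStokesRegularity :=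
  _root_.Summit.NavierStokesRegularity.NavierStokesRegularity.Theses.QuantisedSymmetry.closes hX hB
    _root_.Summit.NavierStokesRegularity.NavierStokesRegularity.Theses.QuantisedSymmetry.ClayUniqueness_holds

/-- **`X⁻ ⇒ stmt-0155`** (the symmetry-free hub crux `Blowup.BlowupTypeIDssProfile`): the polyhedral clauses are load-bearing
nowhere on the summit path (tree `stub_dominatesBlowupProfile`, p156644). [folklore] -/
theorem crux_gives_hub (hX : Crux) :
    _root_.Summit.NavierStokesRegularity.NavierStokesRegularity.Theses.Blowup.BlowupTypeIDssProfile :=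
  _root_.Summit.NavierStokesRegularity.NavierStokesRegularity.Theorems.PolyhedralDssProfileExists.PolyhedralCell.stub_dominatesBlowupProfile
    hX

/-! ## §2 The closing split `X⁻ ⇐ P1 ∧ P2 ∧ P3′` — typed pieces -/

/-- **P1 — a nontrivial polyhedrally-equivariant Type-I ancient mild solution exists** (no periodicity asked): literally the
negation of the route's kill switch `PolyhedralTypeILiouville` (stmt-1405).  Strictly weaker than the crux as a statement
(`ancientPiece_of_crux`); no converse is known or expected without a closing argument (P2 ∧ P3′ of the census). [folklore] -/
def AncientPiece : Prop :=
  ¬ _root_.Summit.NavierStokesRegularity.NavierStokesRegularity.Theses.QuantisedSymmetry.PolyhedralTypeILiouville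

/-- `X⁻ ⇒ P1`: the landed support item `LiouvilleKillsProfile` (stmt-1408, `quantisedSymmetry_liouvilleKillsProfile_proof`:
time shift by `−1` + DSS rescaling), contraposed. [folklore] -/
theorem ancientPiece_of_crux (hX : Crux) : AncientPiece := by
  intro hL
  have h := _root_.Summit.NavierStokesRegularity.NavierStokesRegularity.Theorems.quantisedSymmetry_liouvilleKillsProfile_proof
  unfold _root_.Summit.NavierStokesRegularity.NavierStokesRegularity.Theses.QuantisedSymmetry.LiouvilleKillsProfile at h
  exact h hL hX

/-- **The tree host of P3′ — the closing lemma for hyperbolic measures of `C²` local semiflows with COMPACT injective derivatives**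
(Lian–Young 2012 shape), over the Literature interface `IsHyperbolicSemiflowModel` / `HasAmbientClosing`; as a statement over the
Hilbert phase space of forced Navier–Stokes on 𝕋³ it is the registered open stub `stub_ambientClosing` of
`Summits/AnomalousDissipation/…/Lines/ergodic_budget_selection_closing.lean`.  The backward-similarity Navier–Stokes semiflow on
`C₀,σ(ℝ³)` violates the field `isCompactOperator_fderiv` (far-field transport: the linearised period map is `S + K`, `‖Sⁿ‖ ≤ c⁻ⁿ`,
`K` compact — tree `stub_rdssPeriodPackage`), so the piece the census needs is this statement with compactness weakened to
quasi-compactness (`κ < 0`, Lian–Young 2011 (D2)(ii′) for maps); recorded here only to show WHERE P3′ would live. [folklore] -/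
def CompactClosingLemma (E : Type) [NormedAddCommGroup E] [NormedSpace ℝ E] [MeasurableSpace E] : Prop :=
  ∀ (U Λ : Set E) (g : ℝ → E → E) (m : Measure E), IsHyperbolicSemiflowModel U Λ g m → HasAmbientClosing U Λ g m

/-! ## §3 The even-map lemma has no infinite-dimensional version: a compact even quadratic map with no eigen-ray -/

/-- `Q(v)₀ = 0`, `Q(v)ᵢ₊₁ = 2⁻ⁱ vᵢ²`: even, `2`-homogeneous, vanishing only at `0`; on `ℓ²` continuous and compact. [folklore] -/
def Q (v : ℕ → ℝ) : ℕ → ℝ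
  | 0 => 0
  | i + 1 => (1 / 2 : ℝ) ^ i * (v i) ^ 2

@[simp] theorem Q_zero (v : ℕ → ℝ) : Q v 0 = 0 := rfl

@[simp] theorem Q_succ (v : ℕ → ℝ) (i : ℕ) : Q v (i + 1) = (1 / 2 : ℝ) ^ i * (v i) ^ 2 := rfl

/-- `Q` is even. [folklore] -/
theorem Q_neg (v : ℕ → ℝ) : Q (-v) = Q v := by
  funext n
  cases n <;> simp

/-- `Q` is `2`-homogeneous. [folklore] -/
theorem Q_smul (t : ℝ) (v : ℕ → ℝ) : Q (t • v) = (t ^ 2) • Q v := by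
  funext n
  cases n
  · simp
  · simp [mul_pow]; ring

/-- `Q` vanishes only at `0` (the finite-dimensional lemma's degenerate branch "a nontrivial zero on the sphere" is absent). [folklore] -/
theorem Q_eq_zero_iff (v : ℕ → ℝ) : Q v = 0 ↔ v = 0 := by
  constructor
  · intro h
    funext i
    have hi := congrFun h (i + 1)
    simp only [Q_succ, Pi.zero_apply, mul_eq_zero] at hi
    rcases hi with hi | hi
    · exact absurd hi (by positivity)
    · simpa using hi
  · rintro rfl
    funext n
    cases n <;> simp

/-- **No eigen-ray**: `Q v = μ v` (coordinatewise) forces `v = 0`, for EVERY real `μ` — so the dichotomy "eigen-ray or nontrivial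
zero on the sphere" of the finite-dimensional even-map lemma FAILS for compact even `2`-homogeneous maps of `ℓ²`.  (`μ = 0`:
`Q v = 0 ⇒ v = 0`; `μ ≠ 0`: `v₀ = 0` from the `0`-th coordinate, then `vᵢ = 0 ⇒ vᵢ₊₁ = 0` inductively.) [folklore] -/
theorem no_eigenray (μ : ℝ) (v : ℕ → ℝ) (h : ∀ n, Q v n = μ * v n) : v = 0 := by
  by_cases hμ : μ = 0
  · subst hμ
    refine (Q_eq_zero_iff v).1 (funext fun n => ?_)
    simpa using h n
  · have key : ∀ i, v i = 0 := by
      intro i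
      induction i with
      | zero =>
        have h0 := h 0
        simp only [Q_zero, zero_eq_mul] at h0
        exact h0.resolve_left hμ
      | succ i ih =>
        have hs := h (i + 1)
        simp only [Q_succ, ih] at hs
        have : μ * v (i + 1) = 0 := by simpa using hs.symm
        exact (mul_eq_zero.1 this).resolve_left hμ
    exact funext key

/-- The finite truncations DO have the degenerate branch: on `span(e₀,…,e_N)` the truncated map kills the last basis vector,
a nontrivial zero on the sphere — recorded as the statement that `Q v` never sees `v N` in coordinates `≤ N`. [folklore] -/
theorem Q_truncation_blind (v w : ℕ → ℝ) (N : ℕ) (hvw : ∀ i < N, v i = w i) : ∀ n ≤ N, Q v n = Q w n := by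
  intro n hn
  cases n with
  | zero => rfl
  | succ i => simp [hvw i (by omega)]

end Summit.NavierStokesRegularity.NavierStokesRegularity.Cruxes.PolyhedralDssProfileExists.R1

end
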